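import Summits.QuantumFields.YangMills.Theorems.BalabanUVNodesPortS1LZdetTwinObjects
import Summits.QuantumFields.YangMills.Theorems.BalabanUVNodesPortS1JacOffWrap
import Summits.QuantumFields.YangMills.Theorems.BalabanUVNodesPortS1LZdetGeom
import Literature.MathematicalPhysics.QuantumFieldTheory.Balaban1983to89.Node00.AveragingSkewPresentation

/-!
# NODE O port PT-A — LEVEL-`k` WINDOW GEOMETRY FOR THE INTEGER TWIN (`stub_LZdetTwin` of 27930, line `pta_residueW`): off the centred wrap class the level-`k` cover `π_k` is INJECTIVE on the
# integer sites whose `L·Mc`-block lies in `X̂_K(X)`; central integer bonds cover exactly the central torus bonds there; and an integer sub-cube-set of `X̂_K(X)` that is NOT the lift of a torus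
# domain carries the zero piece ((Z-dom))

Cell `ym-nodeO-ideate`, porter seat `ymgap-nodeO-port-PTA-1` (gen 8); `--supports stmt-QuantumFields-27930` (helper, P0-free).  [I] = [Balaban1987RG1].
Over gen 6's ✓`…JacOffWrap` (`two_mul_abs_lt_of_mem_blockSites_valMinAbs`, `proj_valMinAbs`), ✓`…JacCover` (`coverBondAt_centralBondZ`), ✓`Node00.blockOf_centralBond_src`, ✓`TreeLengthTorus.tFaceConnected_image`.
* §1 `two_mul_abs_lt_levelK` (window bound `2|z_i| < N_k` for `⌊z∕(L·Mc)⌋ ∈ X̂_K(X)`, `X` off the wrap class), ★ `coverAt_levelK_inj_of_blockMap_mem` (injectivity of `π_k` there).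
* §2 `blockMap_centralBondZ_fst`, `isCentralZ_iff_coverBondAt_mem_range` — off the wrap class an integer bond of `X̂_K(X)` is central iff its cover is a central torus bond `b₀(c)`.
* §3 `intCubes_eq_image`, `image_proj_image_valMinAbs`, ★ `twinMat_eq_zero_of_not_lift` — an integer cube set `Ŷ ⊆ X̂_K(X)` which is not the lift of a torus domain `Y ⊆ X` is empty or not
  face-connected (the torus projection of a face-connected set is wall-connected), so its integer piece vanishes by (Z-dom).

HONEST FRAMING.  Torus ∕ integer bookkeeping; NOTHING of Bałaban's estimates asserted, ported or discharged; `stub_LZdetTwin` ∕ `stub_P0C` ∕ `stub_G3C` ∕ `stub_FE` OPEN; 27930 OPEN · no claim; NODE O 0∕1;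
COUNT 8∕28 · K 1∕4 UNMOVED; finite `𝕋⁴_{L^K}` at fixed ε — NOT continuum ∕ OS ∕ Clay; **the Yang–Mills mass gap is NOT proved by any of this.**  No `sorry`, no `def`, no `instance`, no `notation`;
standard axioms.
-/

noncomputable section

open scoped BigOperators Matrix.Norms.L2Operator
open Finset

namespace Summit.QuantumFields.YangMills.Theorems.BalabanUVNodesPortS1

open Summit.QuantumFields.YangMills.Theorems.K0RecordFormatNames
open Literature.MathematicalPhysics.QuantumFieldTheory.Balaban1983to89
open Literature.MathematicalPhysics.QuantumFieldTheory.Balaban1983to89.Node00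
open Literature.MathematicalPhysics.QuantumFieldTheory.Balaban1983to89.T4Continuum (T4Family)
open Literature.MathematicalPhysics.QuantumFieldTheory.Balaban1983to89.TreeLengthTorus (TPt IsTDom proj)
open Literature.MathematicalPhysics.QuantumFieldTheory.Balaban1983to89.BlockAveragingHaarAC (centralBond)
open Literature.MathematicalPhysics.QuantumLattice (blockMap blockSites mem_blockSites_iff)

variable {F : T4Family}

/-! ## §1  The level-`k` window of `X̂_K(X)` off the wrap class: bound and injectivity of `π_k` -/

/-- **The level-`k` window bound**: off the centred wrap class, an integer level-`k` site whose `L·Mc`-block lies in `X̂_K(X)` satisfies `2|z_i| < N_k` (its `L`-block is a level-`(k+1)` integer site of an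
`Mc`-block of `X̂_K(X)`, where ✓`two_mul_abs_lt_of_mem_blockSites_valMinAbs` gives `2|·| < N_{k+1}`; `N_k = L·N_{k+1}`, `N_{k+1}` even). [cite: Balaban1987RG1, (1.21) p.264] -/
theorem two_mul_abs_lt_levelK {Mc k K : ℕ} (hMc : McGuard F Mc) (hK : recordK₀ F Mc k ≤ K) {X : (recordDomSys F Mc k K).Dom} (hX : X ∉ recordWrapCtr F Mc k K)
    {z : Fin (F.P K).d → ℤ} (hz : blockMap (F.L * Mc) z ∈ intCubes F Mc k K X) (i : Fin (F.P K).d) :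
    2 * |z i| < (((F.P K).sitesPerDir k : ℕ) : ℤ) := by
  have hMc0 : 0 < Mc := PortHRecordRowG.mc_pos hMc
  haveI : NeZero Mc := ⟨hMc0.ne'⟩
  have hk : k + 1 ≤ (F.P K).m + (F.P K).K := succ_le_m_add_K_of_recordK₀_le hK
  have hL1 : 1 < F.L := F.hL.2
  have hL0 : (0 : ℤ) < F.L := by exact_mod_cast (by omega : 0 < F.L)
  rw [mem_recordWrapCtr_iff] at hX
  push Not at hX
  obtain ⟨x, hx, hxe⟩ := Finset.mem_image.1 hz
  -- the `L`-block of `z` is an integer site of the `Mc`-block of the centred representative of `x`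
  have hw : blockMap F.L z ∈ blockSites Mc (fun i => (x i).valMinAbs) := by
    rw [mem_blockSites_iff, blockMap_blockMap (P := F.P K)]
    exact hxe.symm
  have h := two_mul_abs_lt_of_mem_blockSites_valMinAbs hMc hK x (hX x hx) hw i
  -- `N_k = N_{k+1} · L`, `N_{k+1}` even
  have hNk : (F.P K).sitesPerDir k = (F.P K).sitesPerDir (k + 1) * F.L := (F.P K).sitesPerDir_eq_mul_succ hk
  have heven : ∃ M' : ℕ, (F.P K).sitesPerDir (k + 1) = 2 * M' := ⟨F.L ^ ((F.P K).m + (F.P K).K - (k + 1)), rfl⟩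
  obtain ⟨M', hM'⟩ := heven
  rw [hM'] at h
  rw [hNk, hM']
  push_cast at h ⊢
  -- `z i = L · w + r`, `0 ≤ r < L`, `w := ⌊z i ∕ L⌋` with `|w| ≤ M' − 1`
  have hdiv : z i = (F.L : ℤ) * (blockMap F.L z i) + z i % (F.L : ℤ) := by
    have := Int.emod_add_mul_ediv (z i) (F.L : ℤ)
    simp only [blockMap]
    linarith
  have hr0 : 0 ≤ z i % (F.L : ℤ) := Int.emod_nonneg _ hL0.ne'
  have hrL : z i % (F.L : ℤ) < F.L := Int.emod_lt_of_pos _ hL0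
  have hw1 : blockMap F.L z i ≤ (M' : ℤ) - 1 := by have := (abs_lt.1 (show |blockMap F.L z i| < M' by linarith)).2; omega
  have hw2 : -((M' : ℤ) - 1) ≤ blockMap F.L z i := by have := (abs_lt.1 (show |blockMap F.L z i| < M' by linarith)).1; omega
  rcases le_or_gt 0 (z i) with hzi | hzi
  · rw [abs_of_nonneg hzi]; nlinarith
  · rw [abs_of_neg hzi]; nlinarith

/-- ★ **`π_k` IS INJECTIVE on the integer level-`k` sites whose `L·Mc`-blocks lie in `X̂_K(X)`**, off the centred wrap class. [cite: Balaban1987RG1, (1.21) p.264] -/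
theorem coverAt_levelK_inj_of_blockMap_mem {Mc k K : ℕ} (hMc : McGuard F Mc) (hK : recordK₀ F Mc k ≤ K) {X : (recordDomSys F Mc k K).Dom} (hX : X ∉ recordWrapCtr F Mc k K)
    {z z' : Fin (F.P K).d → ℤ} (hz : blockMap (F.L * Mc) z ∈ intCubes F Mc k K X) (hz' : blockMap (F.L * Mc) z' ∈ intCubes F Mc k K X)
    (h : coverAt (F.P K) k z = coverAt (F.P K) k z') : z = z' := by
  funext i
  have hdvd : (((F.P K).sitesPerDir k : ℕ) : ℤ) ∣ z' i - z i := (ZMod.intCast_eq_intCast_iff_dvd_sub (z i) (z' i) _).1 (by simpa [coverAt_apply] using congrFun h i)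
  have h1 := two_mul_abs_lt_levelK hMc hK hX hz i
  have h2 := two_mul_abs_lt_levelK hMc hK hX hz' i
  have habs : |z' i - z i| < (((F.P K).sitesPerDir k : ℕ) : ℤ) := by have := abs_sub (z' i) (z i); linarith
  have := Int.eq_zero_of_abs_lt_dvd hdvd habs
  linarith

/-! ## §2  Central integer bonds versus central torus bonds, off the wrap class -/

/-- The source of the integer central bond `b₀(ĉ)` lies in the `L`-block `ĉ₋`: `⌊b₀(ĉ)₋ ∕ L⌋ = ĉ₋`. [cite: Balaban1987RG1, p.267 (bookkeeping)] -/
theorem blockMap_centralBondZ_fst (ĉ : (Fin 4 → ℤ) × Fin 4) : blockMap F.L (centralBondZ F.L ĉ).1 = ĉ.1 := by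
  have hL1 : 1 < F.L := F.hL.2
  have hL0 : (0 : ℤ) < F.L := by exact_mod_cast (by omega : 0 < F.L)
  have hh : (((F.L - 1) / 2 : ℕ) : ℤ) + (((F.L - 1) / 2 : ℕ) : ℤ) < F.L := by
    have : 2 * ((F.L - 1) / 2) ≤ F.L - 1 := Nat.mul_div_le (F.L - 1) 2
    have : ((2 * ((F.L - 1) / 2) : ℕ) : ℤ) ≤ ((F.L - 1 : ℕ) : ℤ) := by exact_mod_cast this
    push_cast at this; omega
  funext i
  simp only [centralBondZ, blockMap]
  by_cases hi : i = ĉ.2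
  · subst hi
    rw [Function.update_self]
    unfold embZ
    rw [add_assoc, add_comm, Int.add_mul_ediv_left _ _ hL0.ne', Int.ediv_eq_zero_of_lt (by positivity) hh, zero_add]
  · rw [Function.update_of_ne hi]
    unfold embZ
    rw [add_comm, Int.add_mul_ediv_left _ _ hL0.ne', Int.ediv_eq_zero_of_lt (by positivity) (by omega), zero_add]

/-- **A central integer bond covers a central torus bond**: `IsCentralZ b̂ ⟹ π_k b̂ = b₀(π_{k+1} ĉ)`, `ĉ = (⌊b̂₋∕L⌋, μ)` (✓`coverBondAt_centralBondZ`; standing range). [cite: Balaban1987RG1, p.267, (1.21) p.264] -/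
theorem coverBondAt_mem_range_centralBond_of_isCentralZ {K k : ℕ} (hk : k + 1 ≤ (F.P K).m + (F.P K).K) {b : (Fin 4 → ℤ) × Fin 4} (hb : IsCentralZ F.L b) :
    coverBondAt (F.P K) k b ∈ Set.range (recordB0 F k K) := by
  refine ⟨coverBondAt (F.P K) (k + 1) (blockMap F.L b.1, b.2), ?_⟩
  show centralBond (coverBondAt (F.P K) (k + 1) (blockMap F.L b.1, b.2)) = coverBondAt (F.P K) k b
  rw [← coverBondAt_centralBondZ hk]
  exact congrArg _ hb

/-- ★ **OFF THE WRAP CLASS, A NON-CENTRAL INTEGER BOND OF `X̂_K(X)` COVERS A NON-CENTRAL TORUS BOND**: if `π_k b̂ = b₀(c)` then `b̂ = b₀(ĉ)` for `ĉ = (⌊b̂₋∕L⌋, μ)` (`c = π_{k+1} ĉ` by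
`blockOf_centralBond_src`; both `b̂₋` and `b₀(ĉ)₋` lie in the injectivity window of `X̂_K(X)`). [cite: Balaban1987RG1, p.267, (1.21) p.264] -/
theorem isCentralZ_of_coverBondAt_mem_range {Mc k K : ℕ} (hMc : McGuard F Mc) (hK : recordK₀ F Mc k ≤ K) {X : (recordDomSys F Mc k K).Dom} (hX : X ∉ recordWrapCtr F Mc k K)
    {b : (Fin 4 → ℤ) × Fin 4} (hbX : blockMap (F.L * Mc) b.1 ∈ intCubes F Mc k K X) (hb : coverBondAt (F.P K) k b ∈ Set.range (recordB0 F k K)) :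
    IsCentralZ F.L b := by
  have hk : k + 1 ≤ (F.P K).m + (F.P K).K := succ_le_m_add_K_of_recordK₀_le hK
  obtain ⟨c, hc⟩ := hb
  change centralBond c = coverBondAt (F.P K) k b at hc
  -- `c = π_{k+1} (⌊b̂₋∕L⌋, μ)`
  have hcsrc : c.src = coverAt (F.P K) (k + 1) (blockMap F.L b.1) := by
    rw [← blockOf_centralBond_src hk c, hc]
    exact blockOf_coverAt hk b.1
  have hcdir : c.dir = b.2 := by
    have := congrArg PBond.dir hc; exact this
  have hc' : c = coverBondAt (F.P K) (k + 1) (blockMap F.L b.1, b.2) := by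
    rcases c with ⟨cs, cd⟩
    simp only at hcsrc hcdir
    subst hcsrc; subst hcdir
    rfl
  -- hence `π_k b̂ = π_k b₀(ĉ)`, and both sources lie in the window
  have hcov : coverBondAt (F.P K) k b = coverBondAt (F.P K) k (centralBondZ F.L (blockMap F.L b.1, b.2)) := by
    rw [← hc, hc']
    exact (coverBondAt_centralBondZ (P := F.P K) hk (blockMap F.L b.1, b.2)).symm
  have hsrc : coverAt (F.P K) k b.1 = coverAt (F.P K) k (centralBondZ F.L (blockMap F.L b.1, b.2)).1 := congrArg PBond.src hcov
  have hz' : blockMap (F.L * Mc) (centralBondZ F.L (blockMap F.L b.1, b.2)).1 ∈ intCubes F Mc k K X := by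
    have e : blockMap (F.L * Mc) (centralBondZ F.L (blockMap F.L b.1, b.2)).1 = blockMap (F.L * Mc) b.1 :=
      calc blockMap (F.L * Mc) (centralBondZ F.L (blockMap F.L b.1, b.2)).1 = blockMap Mc (blockMap F.L (centralBondZ F.L (blockMap F.L b.1, b.2)).1) :=
            (blockMap_blockMap (P := F.P K) F.L Mc _).symm
        _ = blockMap Mc (blockMap F.L b.1) := by rw [blockMap_centralBondZ_fst]
        _ = blockMap (F.L * Mc) b.1 := blockMap_blockMap (P := F.P K) F.L Mc _
    rw [e]; exact hbX
  have heq := coverAt_levelK_inj_of_blockMap_mem hMc hK hX hbX hz' hsrc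
  show centralBondZ F.L (blockMap F.L b.1, b.2) = b
  refine Prod.ext heq.symm ?_
  rfl

/-! ## §3  (Z-dom): integer sub-cube-sets of `X̂_K(X)` that are not lifts of torus domains carry the zero piece -/

/-- `X̂_K(X)` is the image of the cube family under the centred lift (`rfl`, recorded for rewriting). [cite: Balaban1987RG1, (1.21) p.264 (bookkeeping)] -/
theorem intCubes_eq_image (Mc k K : ℕ) (X : (recordDomSys F Mc k K).Dom) :
    intCubes F Mc k K X = (X.1 : Finset (TPt (F.P K).d (Sect2.domCount (F.P K) Mc (k + 1)))).image (fun c i => (c i).valMinAbs) := rfl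

/-- The centred lift is injective on cube indices (its cover is the identity, ✓`proj_valMinAbs`). [cite: Balaban1987RG1, (1.21) p.264 (bookkeeping)] -/
theorem valMinAbs_lift_injective (q : ℕ) : Function.Injective (fun (c : TPt 4 q) (i : Fin 4) => (c i).valMinAbs) := by
  intro a b h
  have := congrArg (proj q) h
  rwa [proj_valMinAbs, proj_valMinAbs] at this

/-- A subset of `X̂_K(X)` is the centred lift of its torus projection. [cite: Balaban1987RG1, (1.21) p.264 (bookkeeping)] -/
theorem image_proj_image_valMinAbs {Mc k K : ℕ} {X : (recordDomSys F Mc k K).Dom} {Yh : Finset (Fin 4 → ℤ)} (hYh : Yh ⊆ intCubes F Mc k K X) :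
    (Yh.image (proj (Sect2.domCount (F.P K) Mc (k + 1)))).image (fun c i => (c i).valMinAbs) = Yh := by
  ext y
  constructor
  · intro hy
    obtain ⟨c, hc, rfl⟩ := Finset.mem_image.1 hy
    obtain ⟨y', hy', rfl⟩ := Finset.mem_image.1 hc
    obtain ⟨x, -, rfl⟩ := Finset.mem_image.1 (hYh hy')
    rw [proj_valMinAbs]; exact hy'
  · intro hy
    obtain ⟨x, -, rfl⟩ := Finset.mem_image.1 (hYh hy)
    exact Finset.mem_image.2 ⟨x, Finset.mem_image.2 ⟨_, hy, proj_valMinAbs x⟩, rfl⟩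

/-- The torus projection of a subset of `X̂_K(X)` lies in the cube family of `X`. [cite: Balaban1987RG1, (1.21) p.264 (bookkeeping)] -/
theorem image_proj_subset {Mc k K : ℕ} {X : (recordDomSys F Mc k K).Dom} {Yh : Finset (Fin 4 → ℤ)} (hYh : Yh ⊆ intCubes F Mc k K X) :
    Yh.image (proj (Sect2.domCount (F.P K) Mc (k + 1))) ⊆ (X.1 : Finset _) := by
  intro c hc
  obtain ⟨y, hy, rfl⟩ := Finset.mem_image.1 hc
  obtain ⟨x, hx, rfl⟩ := Finset.mem_image.1 (hYh hy)
  rw [proj_valMinAbs]; exact hx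

/-- ★ **(Z-dom) AT A NON-LIFT**: if `Ŷ ⊆ X̂_K(X)` is NOT the centred lift `Y ↦ X̂_K(Y)` of any torus domain `Y ⊆ X`, then `Ŷ` is empty or not face-connected (else its torus projection is a wall-connected
non-empty family, ✓`tFaceConnected_image`, whose lift is `Ŷ`), so the integer piece `twinMat … Ŷ f` vanishes by the letter's (Z-dom). [cite: Balaban1987RG1, p.257 (localization domains), (1.21) p.264] -/
theorem twinMat_eq_zero_of_not_lift {Mc k K : ℕ} (X : (recordDomSys F Mc k K).Dom)
    {TZY : Finset (Fin 4 → ℤ) → IntBondCfg → ((Fin 4 → ℤ) × Fin 4) × Fin 3 → ((Fin 4 → ℤ) × Fin 4) × Fin 3 → ℂ}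
    (hZdom : ∀ (Xh : Finset (Fin 4 → ℤ)) (f : IntBondCfg) (i j : ((Fin 4 → ℤ) × Fin 4) × Fin 3), ¬ (Xh.Nonempty ∧ B13ScaleTransfer.FaceConnected Xh) → TZY Xh f i j = 0)
    {Yh : Finset (Fin 4 → ℤ)} (hYh : Yh ⊆ intCubes F Mc k K X)
    (hnot : ∀ Y : (recordDomSys F Mc k K).Dom, (Y.1 : Finset _) ⊆ X.1 → intCubes F Mc k K Y ≠ Yh)
    (Xh : Finset (Fin 4 → ℤ)) (f : IntBondCfg) : twinMat F Mc TZY Xh Yh f = 0 := by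
  ext i j
  simp only [twinMat, Matrix.of_apply, Matrix.zero_apply]
  refine hZdom Yh f _ _ fun ⟨hne, hfc⟩ => ?_
  -- the torus projection of `Ŷ` is a domain `Y ⊆ X` with lift `Ŷ`
  set Y₀ : Finset (TPt (F.P K).d (Sect2.domCount (F.P K) Mc (k + 1))) := Yh.image (proj (Sect2.domCount (F.P K) Mc (k + 1))) with hY₀
  have hdom : IsTDom Y₀ := ⟨hne.image _, TreeLengthTorus.tFaceConnected_image hfc⟩
  exact hnot ⟨Y₀, hdom⟩ (image_proj_subset hYh) (image_proj_image_valMinAbs hYh)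

end Summit.QuantumFields.YangMills.Theorems.BalabanUVNodesPortS1

end
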